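import Summits.Ventures.HSemireg.Mod4OneSlopeSpectrum

/-!
# Venture HSemireg — MOD-4 line: the slope pair `{λ, ∞}` (`f = A e^{λh} + B·pt`, `q_m = A λ^m + B·[m = 2n]`): the middle matrix
# `M_f(q)` has the eigenvalue `AB` on the plane `⟨g_λ, e_0⟩` and is `0` elsewhere; `rank H_k(q) = 2`; `P_f(q) = 2AB` — every `n`

HONEST FRAMING. Part of the Lean index of the computation cell `pub-hsemireg` (seat w3-mod4-1 gen 9, W3 SPECIAL FIBRES;
MOD4-OFFSPLIT TABLE R «ρ(f) = 2 (two distinct slopes in ℂ ∪ {∞}: type II, K′-secant for any K′, or {λ,∞})», LEMMA S (c) (the dual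
twist moving `∞` to a finite slope — pencil)). ELEMENTARY LINEAR ALGEBRA over a field ONLY: no abelian variety, no sheaf, no Ext
group, no semiregularity map; nothing here says that HC / HC_CM / HC_AV holds; no Literature fact is declared; NO definition is
introduced (the sequence `q_m = A λ^m + B·[m = 2n]` — «`A e^{λh} + B·pt`», the point class being `Θ^{2n}/(2n)!` — is written out).

WHAT IS PROVED (the `μ = ∞` companion of `Mod4TwoSlopeSpectrumGeneral`, proved DIRECTLY rather than through the pencil symmetry):
* `hankelT_slopeInf_mulVec` — `(T_f v)_a = A λ^{n-a} (e_λ·v) + [a = 0]·(-1)ⁿ B v_n`;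
* **`middleM_slopeInf_mulVec`** — `(M_f v)_a = AB (v_n λ^{n-a} + [a = 0]·(e_λ·v))` (`n ≥ 1`), i.e. `M_f v = AB (v_n g_λ + (e_λ·v) e_0)`;
* **`finrank_ker_middleM_slopeInf_box`** — `A, B ≠ 0`, `n ≥ 1`: `dim ker(M_f - AB) = 2` (the plane `⟨g_λ, e_0⟩`);
* **`finrank_ker_middleM_slopeInf_generic`** — `t ≠ 0`, `t ≠ AB`: `dim ker(M_f - t) = 0`;
* **`mukaiP_slopeInf`** — `P_f(q) = Σ_{j ≤ 2n} (-1)^j C(2n,j) q_j q_{2n-j} = 2AB` (`n ≥ 1`): again the box locus is `t = P_f(q)/2`;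
* **`hankel1_rank_slopeInf`** — `A, B ≠ 0`, `1 ≤ k ≤ N - 1` (`N = 2n` in the application): `rank H_k(q) = 2` for
  `q_m = A λ^m + B·[m = N]` (the corner entry `(k, N-k)` carries `B`).
Everything PROVED, 0 sorry. Namespace `Summit.Ventures.HSemireg.Mod4`.
References: [BourbakiAlgebre1a3] Ch. III §8; [BuchweitzFlenner2008HH] Prop. 6.4.4 (why this matrix).
-/

namespace Summit.Ventures.HSemireg.Mod4

open Finset Matrix

variable {K : Type*} [Field K]

/-! ### 1. `T_f` and `M_f` on a vector for `q_m = A λ^m + B·[m = 2n]` -/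

/-- the indicator `[n - a + b = 2n]` on `a, b ≤ n` is `[a = 0 ∧ b = n]`. -/
lemma ite_sub_add_eq_add {n : ℕ} (a b : Fin (n + 1)) :
    (if n - (a : ℕ) + (b : ℕ) = n + n then (1 : K) else 0) = if ((a : ℕ) = 0 ∧ b = Fin.last n) then 1 else 0 := by
  have ha := a.2; have hb := b.2
  by_cases h : (a : ℕ) = 0 ∧ b = Fin.last n
  · obtain ⟨h0, rfl⟩ := h
    rw [if_pos (by rw [h0, Fin.val_last]; omega), if_pos ⟨h0, rfl⟩]
  · rw [if_neg h, if_neg]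
    intro hc
    apply h
    refine ⟨by omega, Fin.ext ?_⟩
    rw [Fin.val_last]; omega

/-- **`(T_f v)_a = A λ^{n-a} (e_λ·v) + [a = 0]·(-1)ⁿ B v_n`** for `q_m = A λ^m + B·[m = 2n]`. [cite: BourbakiAlgebre1a3, Ch. III §8] -/
theorem hankelT_slopeInf_mulVec (n : ℕ) (A B la : K) (v : Fin (n + 1) → K) (a : Fin (n + 1)) :
    ((hankelT n (fun m => A * la ^ m + B * (if m = n + n then 1 else 0))) *ᵥ v) a =
      A * la ^ (n - (a : ℕ)) * ((fun b : Fin (n + 1) => (-1 : K) ^ (b : ℕ) * (n.choose (b : ℕ) : K) * la ^ (b : ℕ)) ⬝ᵥ v) +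
        (if (a : ℕ) = 0 then (-1 : K) ^ n * B * v (Fin.last n) else 0) := by
  simp only [mulVec, dotProduct, hankelT, ite_sub_add_eq_add]
  have hsplit : ∀ b : Fin (n + 1), (-1 : K) ^ (b : ℕ) * (n.choose (b : ℕ) : K) *
      (A * la ^ (n - (a : ℕ) + (b : ℕ)) + B * (if ((a : ℕ) = 0 ∧ b = Fin.last n) then 1 else 0)) * v b =
      A * la ^ (n - (a : ℕ)) * ((-1 : K) ^ (b : ℕ) * (n.choose (b : ℕ) : K) * la ^ (b : ℕ) * v b) +
        (if ((a : ℕ) = 0 ∧ b = Fin.last n) then (-1 : K) ^ (b : ℕ) * (n.choose (b : ℕ) : K) * B * v b else 0) := by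
    intro b
    rw [pow_add]
    split_ifs <;> ring
  rw [Finset.sum_congr rfl (fun b _ => hsplit b), Finset.sum_add_distrib, ← Finset.mul_sum]
  congr 1
  by_cases ha : (a : ℕ) = 0
  · simp only [ha, true_and, if_true, Finset.sum_ite_eq', Finset.mem_univ, Fin.val_last, Nat.choose_self, Nat.cast_one, mul_one]
  · simp only [ha, false_and, if_false, Finset.sum_const_zero]

/-- **`(M_f v)_a = AB·(v_n λ^{n-a} + [a = 0]·(e_λ·v))`** (`n ≥ 1`) for `q_m = A λ^m + B·[m = 2n]`: `M_f = AB·(g_λ e_nᵀ + e_0 e_λᵀ)`.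
[cite: BourbakiAlgebre1a3, Ch. III §8] -/
theorem middleM_slopeInf_mulVec {n : ℕ} (hn : 1 ≤ n) (A B la : K) (v : Fin (n + 1) → K) (a : Fin (n + 1)) :
    ((middleM n (fun m => A * la ^ m + B * (if m = n + n then 1 else 0))) *ᵥ v) a =
      A * B * (v (Fin.last n) * la ^ (n - (a : ℕ)) +
        (if (a : ℕ) = 0 then ((fun b : Fin (n + 1) => (-1 : K) ^ (b : ℕ) * (n.choose (b : ℕ) : K) * la ^ (b : ℕ)) ⬝ᵥ v) else 0)) := by
  have hsq : ((-1 : K) ^ n) * (-1 : K) ^ n = 1 := by rw [← pow_add, ← two_mul, pow_mul, neg_one_sq, one_pow]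
  -- the inner vector `T v`
  have hTv : (hankelT n (fun m => A * la ^ m + B * (if m = n + n then 1 else 0))) *ᵥ v =
      fun a : Fin (n + 1) => A * la ^ (n - (a : ℕ)) * ((fun b : Fin (n + 1) => (-1 : K) ^ (b : ℕ) * (n.choose (b : ℕ) : K) * la ^ (b : ℕ)) ⬝ᵥ v) +
        (if (a : ℕ) = 0 then (-1 : K) ^ n * B * v (Fin.last n) else 0) :=
    funext fun a => hankelT_slopeInf_mulVec n A B la v a
  -- `e_λ · (T v) = (-1)ⁿ B v_n` and `(T v)_n = A (e_λ·v)`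
  have hdot : (fun b : Fin (n + 1) => (-1 : K) ^ (b : ℕ) * (n.choose (b : ℕ) : K) * la ^ (b : ℕ)) ⬝ᵥ
      ((hankelT n (fun m => A * la ^ m + B * (if m = n + n then 1 else 0))) *ᵥ v) = (-1 : K) ^ n * B * v (Fin.last n) := by
    rw [hTv]
    have h1 : (fun b : Fin (n + 1) => (-1 : K) ^ (b : ℕ) * (n.choose (b : ℕ) : K) * la ^ (b : ℕ)) ⬝ᵥ
        (fun a : Fin (n + 1) => A * la ^ (n - (a : ℕ)) *
            ((fun b : Fin (n + 1) => (-1 : K) ^ (b : ℕ) * (n.choose (b : ℕ) : K) * la ^ (b : ℕ)) ⬝ᵥ v) +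
          (if (a : ℕ) = 0 then (-1 : K) ^ n * B * v (Fin.last n) else 0)) =
        (fun b : Fin (n + 1) => (-1 : K) ^ (b : ℕ) * (n.choose (b : ℕ) : K) * la ^ (b : ℕ)) ⬝ᵥ
            ((A * ((fun b : Fin (n + 1) => (-1 : K) ^ (b : ℕ) * (n.choose (b : ℕ) : K) * la ^ (b : ℕ)) ⬝ᵥ v)) •
              (fun a : Fin (n + 1) => la ^ (n - (a : ℕ)))) +
          (fun b : Fin (n + 1) => (-1 : K) ^ (b : ℕ) * (n.choose (b : ℕ) : K) * la ^ (b : ℕ)) ⬝ᵥ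
            (fun a : Fin (n + 1) => if (a : ℕ) = 0 then (-1 : K) ^ n * B * v (Fin.last n) else 0) := by
      rw [← dotProduct_add]
      congr 1
      ext a
      simp only [Pi.add_apply, Pi.smul_apply, smul_eq_mul]
      ring
    rw [h1, dotProduct_smul, altBinom_dotProduct_geom_self hn, smul_zero, zero_add, dotProduct]
    rw [Finset.sum_eq_single (⟨0, by omega⟩ : Fin (n + 1))]
    · simp only [if_true, pow_zero, Nat.choose_zero_right, Nat.cast_one, one_mul]
    · intro b _ hb
      rw [if_neg (fun h => hb (Fin.ext h)), mul_zero]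
    · intro h; exact absurd (Finset.mem_univ _) h
  have hlast : ((hankelT n (fun m => A * la ^ m + B * (if m = n + n then 1 else 0))) *ᵥ v) (Fin.last n) =
      A * ((fun b : Fin (n + 1) => (-1 : K) ^ (b : ℕ) * (n.choose (b : ℕ) : K) * la ^ (b : ℕ)) ⬝ᵥ v) := by
    rw [hankelT_slopeInf_mulVec, Fin.val_last, if_neg (by omega), add_zero, Nat.sub_self, pow_zero, mul_one]
  rw [middleM_eq_smul_hankelT_sq, smul_mulVec, ← mulVec_mulVec, Pi.smul_apply, hankelT_slopeInf_mulVec, hdot, hlast, smul_eq_mul]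
  by_cases ha : (a : ℕ) = 0
  · rw [if_pos ha, if_pos ha]
    linear_combination (B * v (Fin.last n) * A * la ^ (n - (a : ℕ)) +
      B * (A * ((fun b : Fin (n + 1) => (-1 : K) ^ (b : ℕ) * (n.choose (b : ℕ) : K) * la ^ (b : ℕ)) ⬝ᵥ v))) * hsq
  · rw [if_neg ha, if_neg ha, add_zero, add_zero]
    linear_combination (B * v (Fin.last n) * A * la ^ (n - (a : ℕ))) * hsq

/-! ### 2. The spectrum -/

/-- **box case for `{λ, ∞}`:** `A, B ≠ 0`, `n ≥ 1` ⇒ `dim ker(M_f(q) - AB) = 2` for `q_m = A λ^m + B·[m = 2n]` (eigenplane `⟨g_λ, e_0⟩`).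
[cite: BourbakiAlgebre1a3, Ch. III §8] -/
theorem finrank_ker_middleM_slopeInf_box {n : ℕ} (hn : 1 ≤ n) {A B : K} (la : K) (hA : A ≠ 0) (hB : B ≠ 0) :
    Module.finrank K ↥(LinearMap.ker (Matrix.toLin' (middleM n (fun m => A * la ^ m + B * (if m = n + n then 1 else 0))) -
      (A * B) • LinearMap.id)) = 2 := by
  set gl : Fin (n + 1) → K := fun a => la ^ (n - (a : ℕ)) with hgl
  set e0 : Fin (n + 1) → K := fun a => if (a : ℕ) = 0 then 1 else 0 with he0
  have hc : A * B ≠ 0 := mul_ne_zero hA hB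
  have hM : ∀ v : Fin (n + 1) → K, (middleM n (fun m => A * la ^ m + B * (if m = n + n then 1 else 0))) *ᵥ v =
      (A * B * v (Fin.last n)) • gl +
        (A * B * ((fun b : Fin (n + 1) => (-1 : K) ^ (b : ℕ) * (n.choose (b : ℕ) : K) * la ^ (b : ℕ)) ⬝ᵥ v)) • e0 := by
    intro v; ext a
    rw [middleM_slopeInf_mulVec hn]
    simp only [hgl, he0, Pi.add_apply, Pi.smul_apply, smul_eq_mul, mul_ite, mul_one, mul_zero]
    split_ifs <;> ring
  have hli : LinearIndependent K ![gl, e0] := by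
    rw [LinearIndependent.pair_iff]
    intro s t hst
    have h1 := congr_fun hst (Fin.last n)
    have h2 := congr_fun hst ⟨0, by omega⟩
    simp only [hgl, he0, Pi.add_apply, Pi.smul_apply, smul_eq_mul, Pi.zero_apply, Fin.val_last, Nat.sub_self, pow_zero, mul_one,
      show ¬ (n = 0) from by omega, if_false, mul_zero, add_zero] at h1
    simp only [hgl, he0, Pi.add_apply, Pi.smul_apply, smul_eq_mul, Pi.zero_apply, if_true, mul_one, h1, zero_mul, zero_add] at h2
    exact ⟨h1, h2⟩
  have hker : LinearMap.ker (Matrix.toLin' (middleM n (fun m => A * la ^ m + B * (if m = n + n then 1 else 0))) -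
      (A * B) • LinearMap.id) = Submodule.span K (Set.range ![gl, e0]) := by
    apply le_antisymm
    · intro v hv
      rw [LinearMap.mem_ker, LinearMap.sub_apply, Matrix.toLin'_apply, LinearMap.smul_apply, LinearMap.id_apply, sub_eq_zero,
        hM] at hv
      have hv' : v = (A * B)⁻¹ • ((A * B * v (Fin.last n)) • gl +
          (A * B * ((fun b : Fin (n + 1) => (-1 : K) ^ (b : ℕ) * (n.choose (b : ℕ) : K) * la ^ (b : ℕ)) ⬝ᵥ v)) • e0) := by
        rw [hv, smul_smul, inv_mul_cancel₀ hc, one_smul]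
      rw [hv']
      exact Submodule.smul_mem _ _ (Submodule.add_mem _ (Submodule.smul_mem _ _ (Submodule.subset_span ⟨0, rfl⟩))
        (Submodule.smul_mem _ _ (Submodule.subset_span ⟨1, rfl⟩)))
    · rw [Submodule.span_le]
      rintro _ ⟨i, rfl⟩
      rw [SetLike.mem_coe, LinearMap.mem_ker, LinearMap.sub_apply, Matrix.toLin'_apply, LinearMap.smul_apply, LinearMap.id_apply,
        sub_eq_zero, hM]
      fin_cases i
      · -- `gl`: `v_n = 1`, `e_λ · g_λ = 0`
        show (A * B * gl (Fin.last n)) • gl +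
            (A * B * ((fun b : Fin (n + 1) => (-1 : K) ^ (b : ℕ) * (n.choose (b : ℕ) : K) * la ^ (b : ℕ)) ⬝ᵥ gl)) • e0 = (A * B) • gl
        rw [hgl, altBinom_dotProduct_geom_self hn, mul_zero, zero_smul, add_zero]
        simp only [Fin.val_last, Nat.sub_self, pow_zero, mul_one]
      · -- `e0`: `v_n = 0`, `e_λ · e_0 = 1`
        show (A * B * e0 (Fin.last n)) • gl +
            (A * B * ((fun b : Fin (n + 1) => (-1 : K) ^ (b : ℕ) * (n.choose (b : ℕ) : K) * la ^ (b : ℕ)) ⬝ᵥ e0)) • e0 = (A * B) • e0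
        have hd : (fun b : Fin (n + 1) => (-1 : K) ^ (b : ℕ) * (n.choose (b : ℕ) : K) * la ^ (b : ℕ)) ⬝ᵥ e0 = 1 := by
          rw [dotProduct, Finset.sum_eq_single (⟨0, by omega⟩ : Fin (n + 1))]
          · simp only [he0, if_true, pow_zero, Nat.choose_zero_right, Nat.cast_one, mul_one]
          · intro b _ hb
            rw [he0]
            simp only [show ¬ ((b : ℕ) = 0) from fun h => hb (Fin.ext h), if_false, mul_zero]
          · intro h; exact absurd (Finset.mem_univ _) h
        rw [hd, mul_one]
        simp only [he0, Fin.val_last, show ¬ (n = 0) from by omega, if_false, mul_zero, zero_smul, zero_add]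
  rw [hker, finrank_span_eq_card hli, Fintype.card_fin]

/-- **generic case for `{λ, ∞}`:** `t ≠ 0`, `t ≠ AB`, `n ≥ 1` ⇒ `dim ker(M_f(q) - t) = 0` for `q_m = A λ^m + B·[m = 2n]`.
[cite: BourbakiAlgebre1a3, Ch. III §8] -/
theorem finrank_ker_middleM_slopeInf_generic {n : ℕ} (hn : 1 ≤ n) (A B la : K) {t : K} (ht0 : t ≠ 0) (ht : t ≠ A * B) :
    Module.finrank K ↥(LinearMap.ker (Matrix.toLin' (middleM n (fun m => A * la ^ m + B * (if m = n + n then 1 else 0))) -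
      t • LinearMap.id)) = 0 := by
  rw [Submodule.finrank_eq_zero, LinearMap.ker_eq_bot']
  intro v hv
  rw [LinearMap.sub_apply, Matrix.toLin'_apply, LinearMap.smul_apply, LinearMap.id_apply, sub_eq_zero] at hv
  -- coordinate `n`: `AB v_n = t v_n`
  have hn' := congr_fun hv (Fin.last n)
  rw [middleM_slopeInf_mulVec hn, Pi.smul_apply, smul_eq_mul, Fin.val_last, if_neg (by omega), add_zero, Nat.sub_self, pow_zero,
    mul_one] at hn'
  have hvn : v (Fin.last n) = 0 := by
    have h : (A * B - t) * v (Fin.last n) = 0 := by linear_combination hn'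
    exact (mul_eq_zero.mp h).resolve_left (sub_ne_zero.mpr (Ne.symm ht))
  -- coordinate `0`: `AB (e_λ·v) = t v_0`; and pairing with `e_λ`: `AB (e_λ·v) = t (e_λ·v)`
  have hd := congrArg (fun w => (fun b : Fin (n + 1) => (-1 : K) ^ (b : ℕ) * (n.choose (b : ℕ) : K) * la ^ (b : ℕ)) ⬝ᵥ w) hv
  have hMv : (middleM n (fun m => A * la ^ m + B * (if m = n + n then 1 else 0))) *ᵥ v =
      (A * B * ((fun b : Fin (n + 1) => (-1 : K) ^ (b : ℕ) * (n.choose (b : ℕ) : K) * la ^ (b : ℕ)) ⬝ᵥ v)) •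
        (fun a : Fin (n + 1) => if (a : ℕ) = 0 then (1 : K) else 0) := by
    ext a
    rw [middleM_slopeInf_mulVec hn, hvn, zero_mul, zero_add, Pi.smul_apply, smul_eq_mul]
    split_ifs <;> ring
  have he : (fun b : Fin (n + 1) => (-1 : K) ^ (b : ℕ) * (n.choose (b : ℕ) : K) * la ^ (b : ℕ)) ⬝ᵥ
      (fun a : Fin (n + 1) => if (a : ℕ) = 0 then (1 : K) else 0) = 1 := by
    rw [dotProduct, Finset.sum_eq_single (⟨0, by omega⟩ : Fin (n + 1))]
    · simp only [if_true, pow_zero, Nat.choose_zero_right, Nat.cast_one, mul_one]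
    · intro b _ hb
      simp only [show ¬ ((b : ℕ) = 0) from fun h => hb (Fin.ext h), if_false, mul_zero]
    · intro h; exact absurd (Finset.mem_univ _) h
  simp only [hMv, dotProduct_smul, smul_eq_mul, he, mul_one] at hd
  have hd0 : (fun b : Fin (n + 1) => (-1 : K) ^ (b : ℕ) * (n.choose (b : ℕ) : K) * la ^ (b : ℕ)) ⬝ᵥ v = 0 := by
    have h : (A * B - t) * ((fun b : Fin (n + 1) => (-1 : K) ^ (b : ℕ) * (n.choose (b : ℕ) : K) * la ^ (b : ℕ)) ⬝ᵥ v) = 0 := by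
      linear_combination hd
    exact (mul_eq_zero.mp h).resolve_left (sub_ne_zero.mpr (Ne.symm ht))
  rw [hMv, hd0, mul_zero, zero_smul] at hv
  exact (smul_eq_zero.mp hv.symm).resolve_left ht0

/-! ### 3. The Mukai self-pairing and the Hankel rank for `{λ, ∞}` -/

/-- **`P_f(q) = 2AB`** for `q_m = A λ^m + B·[m = 2n]`, `n ≥ 1`. [cite: BourbakiAlgebre1a3, Ch. III §8] -/
theorem mukaiP_slopeInf {n : ℕ} (hn : 1 ≤ n) (A B la : K) :
    ∑ j ∈ Finset.range (n + n + 1), (-1 : K) ^ j * (((n + n).choose j : ℕ) : K) *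
        ((A * la ^ j + B * (if j = n + n then 1 else 0)) * (A * la ^ (n + n - j) + B * (if n + n - j = n + n then 1 else 0))) =
      2 * (A * B) := by
  have hsame : ∑ j ∈ Finset.range (n + n + 1), (-1 : K) ^ j * (((n + n).choose j : ℕ) : K) * (la ^ j * la ^ (n + n - j)) = 0 := by
    have h := mukaiP_oneSlope hn (1 : K) la
    simpa only [one_mul] using h
  have hsplit : ∀ j ∈ Finset.range (n + n + 1), (-1 : K) ^ j * (((n + n).choose j : ℕ) : K) *
      ((A * la ^ j + B * (if j = n + n then 1 else 0)) * (A * la ^ (n + n - j) + B * (if n + n - j = n + n then 1 else 0))) =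
      A * A * ((-1 : K) ^ j * (((n + n).choose j : ℕ) : K) * (la ^ j * la ^ (n + n - j))) +
        (if j = 0 then A * B else 0) + (if j = n + n then A * B else 0) := by
    intro j hj
    rw [Finset.mem_range] at hj
    by_cases h0 : j = 0
    · subst h0
      rw [if_neg (by omega), if_pos (by omega), if_pos rfl, if_neg (by omega)]
      simp only [pow_zero, Nat.choose_zero_right, Nat.cast_one, Nat.sub_zero, mul_zero, add_zero, mul_one, one_mul]
      ring
    · by_cases h2 : j = n + n
      · subst h2
        rw [if_pos rfl, if_neg (by omega), if_neg (by omega), if_pos rfl]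
        have hev : (-1 : K) ^ (n + n) = 1 := by rw [← two_mul, pow_mul, neg_one_sq, one_pow]
        simp only [hev, Nat.choose_self, Nat.cast_one, Nat.sub_self, pow_zero, mul_zero, add_zero, mul_one, one_mul]
        ring
      · rw [if_neg h2, if_neg (by omega), if_neg h0, if_neg h2]
        ring
  rw [Finset.sum_congr rfl hsplit, Finset.sum_add_distrib, Finset.sum_add_distrib, ← Finset.mul_sum, hsame,
    Finset.sum_ite_eq' (Finset.range (n + n + 1)) 0, Finset.sum_ite_eq' (Finset.range (n + n + 1)) (n + n)]
  simp
  ring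

/-- **`rank H_k(q) = 2`** for `q_m = A λ^m + B·[m = N]`, `A, B ≠ 0`, `1 ≤ k`, `k + 1 ≤ N`: the range is the plane of `(λ^i)_i` and
the last basis vector `e_k` (the corner entry). [cite: BourbakiAlgebre1a3, Ch. III §8] -/
theorem hankel1_rank_slopeInf {N k : ℕ} (hk1 : 1 ≤ k) (hkN : k + 1 ≤ N) {A B : K} (la : K) (hA : A ≠ 0) (hB : B ≠ 0) :
    (Wedge.Hankel.hankel1 K N k (fun m => A * la ^ m + B * (if m = N then 1 else 0))).rank = 2 := by
  classical
  set H := Wedge.Hankel.hankel1 K N k (fun m => A * la ^ m + B * (if m = N then 1 else 0)) with hH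
  set gl : Fin (k + 1) → K := fun i => la ^ (i : ℕ) with hgl
  set ek : Fin (k + 1) → K := fun i => if (i : ℕ) = k then 1 else 0 with hek
  -- `H v = A (Σ λ^s v_s) gl + B v_{N-k} ek`
  have hidx : ∀ (i : Fin (k + 1)) (s : Fin (N + 1 - k)), ((i : ℕ) + (s : ℕ) = N) ↔ ((i : ℕ) = k ∧ (s : ℕ) = N - k) := by
    intro i s; have hi := i.2; have hs := s.2; omega
  have hmul : ∀ v : Fin (N + 1 - k) → K,
      H *ᵥ v = (A * ∑ s : Fin (N + 1 - k), la ^ (s : ℕ) * v s) • gl + (B * v ⟨N - k, by omega⟩) • ek := by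
    intro v; ext i
    simp only [hH, Wedge.Hankel.hankel1, mulVec, dotProduct, Matrix.of_apply, hgl, hek, Pi.add_apply, Pi.smul_apply, smul_eq_mul]
    have hs : ∀ s : Fin (N + 1 - k), (A * la ^ ((i : ℕ) + (s : ℕ)) + B * (if (i : ℕ) + (s : ℕ) = N then 1 else 0)) * v s =
        A * la ^ (i : ℕ) * (la ^ (s : ℕ) * v s) +
          (if (i : ℕ) = k then (if s = ⟨N - k, by omega⟩ then B * v s else 0) else 0) := by
      intro s
      rw [pow_add]
      by_cases hik : (i : ℕ) = k
      · by_cases hsk : s = ⟨N - k, by omega⟩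
        · subst hsk; rw [if_pos (by simp only []; omega), if_pos hik, if_pos rfl]; ring
        · rw [if_neg (by intro h; apply hsk; exact Fin.ext (by simp only []; omega)), if_pos hik, if_neg hsk]; ring
      · rw [if_neg (by omega), if_neg hik]; ring
    rw [Finset.sum_congr rfl (fun s _ => hs s), Finset.sum_add_distrib, ← Finset.mul_sum]
    by_cases hik : (i : ℕ) = k
    · simp only [hik, if_true, Finset.sum_ite_eq', Finset.mem_univ, mul_one]
      ring
    · simp only [hik, if_false, Finset.sum_const_zero, mul_zero]
      ring
  have hli : LinearIndependent K ![gl, ek] := by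
    rw [LinearIndependent.pair_iff]
    intro s t hst
    have h0 := congr_fun hst ⟨0, by omega⟩
    have hk := congr_fun hst ⟨k, by omega⟩
    simp only [hgl, hek, Pi.add_apply, Pi.smul_apply, smul_eq_mul, Pi.zero_apply, pow_zero, mul_one,
      show ¬ ((0 : ℕ) = k) from by omega, if_false, mul_zero, add_zero] at h0
    simp only [hgl, hek, Pi.add_apply, Pi.smul_apply, smul_eq_mul, Pi.zero_apply, if_true, mul_one, h0, zero_mul, zero_add] at hk
    exact ⟨h0, hk⟩
  have hrange : LinearMap.range H.mulVecLin = Submodule.span K (Set.range ![gl, ek]) := by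
    apply le_antisymm
    · rintro _ ⟨v, rfl⟩
      rw [Matrix.mulVecLin_apply, hmul]
      exact Submodule.add_mem _ (Submodule.smul_mem _ _ (Submodule.subset_span ⟨0, rfl⟩))
        (Submodule.smul_mem _ _ (Submodule.subset_span ⟨1, rfl⟩))
    · have hc0 : H *ᵥ Pi.single (⟨0, by omega⟩ : Fin (N + 1 - k)) 1 = A • gl := by
        rw [hmul]
        have hne : (⟨N - k, by omega⟩ : Fin (N + 1 - k)) ≠ ⟨0, by omega⟩ := by
          intro h; have := congrArg Fin.val h; simp only [] at this; omega
        simp only [Pi.single_apply, mul_ite, mul_one, mul_zero, Finset.sum_ite_eq', Finset.mem_univ, if_true, pow_zero, hne,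
          if_false, zero_smul, add_zero]
      have hcl : H *ᵥ Pi.single (⟨N - k, by omega⟩ : Fin (N + 1 - k)) 1 = (A * la ^ (N - k)) • gl + B • ek := by
        rw [hmul]
        simp only [Pi.single_apply, mul_ite, mul_one, mul_zero, Finset.sum_ite_eq', Finset.mem_univ, if_true]
      have hm0 : H *ᵥ Pi.single (⟨0, by omega⟩ : Fin (N + 1 - k)) 1 ∈ LinearMap.range H.mulVecLin := ⟨_, rfl⟩
      have hml : H *ᵥ Pi.single (⟨N - k, by omega⟩ : Fin (N + 1 - k)) 1 ∈ LinearMap.range H.mulVecLin := ⟨_, rfl⟩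
      rw [hc0] at hm0
      rw [hcl] at hml
      have hglm : gl ∈ LinearMap.range H.mulVecLin := by
        rw [show gl = A⁻¹ • (A • gl) by rw [smul_smul, inv_mul_cancel₀ hA, one_smul]]
        exact Submodule.smul_mem _ _ hm0
      have hekm : ek ∈ LinearMap.range H.mulVecLin := by
        have h : B • ek = ((A * la ^ (N - k)) • gl + B • ek) - (A * la ^ (N - k)) • gl := by abel
        rw [show ek = B⁻¹ • (B • ek) by rw [smul_smul, inv_mul_cancel₀ hB, one_smul], h]
        exact Submodule.smul_mem _ _ (Submodule.sub_mem _ hml (Submodule.smul_mem _ _ hglm))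
      rw [Submodule.span_le]
      rintro _ ⟨i, rfl⟩
      fin_cases i
      · exact hglm
      · exact hekm
  change Module.finrank K ↥(LinearMap.range H.mulVecLin) = 2
  rw [hrange, finrank_span_eq_card hli, Fintype.card_fin]

end Summit.Ventures.HSemireg.Mod4
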